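import Summits.CriticalPhenomena.SAWScalingLimit.Theses.SAWSteinDefect
import Literature.Probability.RandomPlanarGeometry.DiagonalDressedSAW
import Literature.Probability.RandomPlanarGeometry.SAWSideProbability
import HarnessLib.Audit

/-!
# Crux `CubicRemainder` (stmt-CriticalPhenomena-7518) — birth skeleton `Lines/birth.lean`

Route `SAWSteinDefect` (route-CriticalPhenomena-SAWSteinDefect), crux BY NAME:
`Summit.CriticalPhenomena.SAWScalingLimit.Theses.SAWSteinDefect.CubicRemainder` — along the critical
`δℤ²` SAW `γ` of a Dobrushin domain `(D; a, b)` with hull subdomain `D'`, with `q_n = Q δ γ n` the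
lattice excursion-avoidance ratio of the past `γ[0,n]` (`1[past ⊆ cl D'] · H'/H`), the expected
TAYLOR REMAINDER of `f(q) = q^{5/8}` summed along the walk,
`E_δ Σ_{n<N} R_n`, `R_n = q_{n+1}^{5/8} − q_n^{5/8} − (5/8) q_n^{−3/8} Δq_n + (15/128) q_n^{−11/8} Δq_n²`,
tends to `0` as `δ → 0⁺`.

## The line: split the remainder by STEP TYPE (the route's own two-layer plan for (R))

Every step `n → n+1` of the walk is of exactly one of four types according to the zero set of the
value process: interior (`q_n ≠ 0`, `q_{n+1} ≠ 0`), absorption (`q_n ≠ 0`, `q_{n+1} = 0`: the past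
leaves `cl D'`, or the tip becomes doomed), re-entry (`q_n = 0`, `q_{n+1} ≠ 0`) and dead
(`q_n = q_{n+1} = 0`, where `R_n = 0` with Lean's conventions `0^(5/8) = 0`).  On an absorption step
the remainder is EXACTLY `R_n = −(33/128) q_n^{5/8}` (`−1 + 5/8 + 15/128 = −33/128`; uses `q_n ≥ 0`,
`0 ^ (5/8) = 0`, `x^{−3/8}·x = x^{5/8}`, `x^{−11/8}·x² = x^{5/8}`), proved below (`summand_abs_le`).
Hence, pointwise along every walk,
`|Σ_n R_n| ≤ Σ_{interior n} |R_n| + (33/128) Σ_{absorption n} q_n^{5/8} + Σ_{re-entry n} q_{n+1}^{5/8}`,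
and the three registered stubs say that the three right-hand contributions vanish:

* `stub_noReentry` (N, lattice potential theory, provable now, M): for `δ > 0` the value process is
  absorbed at `0` — `q_n = 0 ⇒ q_{n+1} = 0` for `n < |γ|` (ranges of initial pieces increase; the
  excursion masses `H ⊇ H'` are summable sub-Markov series, and prepending the step `γ_n → γ_{n+1}`
  injects the `H'`-admissible walks from `γ_{n+1}` into those from `γ_n` at cost `1/4`, so
  `H'(γ[0,n]) ≥ ¼ H'(γ[0,n+1])`; `H(γ[0,n]) > 0` because the walk's own future is admissible).
  So re-entry steps do not occur.
* `stub_absorption` (A, OPEN, L — "the tip reaches `∂D'` only from pasts with small `q`"):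
  `E_δ Σ_n 1[q_n ≠ 0, q_{n+1} = 0] q_n^{5/8} → 0`.  Absorption happens at most once per walk, so this
  is `E_δ[q_{τ−1}^{5/8}; τ ≤ N] → 0`: the law-averaged value of the excursion-avoidance ratio one step
  before the past exits `cl D'` vanishes (discrete Beurling / gambler's-ruin decay of `q` at lattice
  distance `O(1)` from `D ∖ D'`, uniformly over SAW pasts with fjords).
* `stub_interiorRemainder` (C, OPEN, L — third-order smallness of the interior jumps):
  `E_δ Σ_n 1[q_n ≠ 0, q_{n+1} ≠ 0] |R_n| → 0`.  For interior steps `R_n` is a genuine third-order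
  Taylor remainder, `|R_n| ≍ q_n^{−11/8} Δq_n² · min(1, |Δq_n|/q_n)`; the content is
  `|Δq/q| ≲ 1/k` at lattice distance `kδ` from `D ∖ D'` (discrete Harnack at a slit tip) and no
  pile-up of steps near `∂D'` — the route's "bulk" half of (R).

`CubicRemainder_of (hN) (hA) (hC) : CubicRemainder` is PROVED below (no sorry): the pointwise
inequality is summed (`sum_abs_le`), integrated against the critical SAW law for `δ > 0` — there the
walk space is finite (`SAW.finite_domainSAW`, bounded Jordan carrier) and the law has mass `≤ 1`
(`SAW.law_apply_le_one`), so every functional is integrable (`Integrable.of_finite`) and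
`|∫ Σ R| ≤ ∫ Σ_int |R| + (33/128) ∫ Σ_abs q^{5/8}` (`abs_integral_le_integral_abs`,
`integral_mono_of_nonneg`, `integral_add`, `integral_const_mul`) — and squeezed
(`squeeze_zero_norm'` along `𝓝[>] 0`, `self_mem_nhdsWithin`).  The abstract step is
`tendsto_integral_remainder` (arbitrary value process `Q`).

Sorries: exactly 3 = the three `stub_*`; zero elsewhere.  Disproof used: none (no `Disproof.lean` on
this crux: `ledger crux ls stmt-CriticalPhenomena-7518` → "no workfiles yet", 2026-08-17).  Negatives
honoured: stmt-CriticalPhenomena-0772 (all-`δ` tightness) is not used; every statement is along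
`δ → 0⁺` or at fixed `δ > 0`.  BC3 probes (planner folder `bc/probe_*.lean`): `stub → CubicRemainder`
and `stub → SAWScalingLimit` by `first | exact? | simpa | aesop` FAIL for all three stubs
(see `Lines/birth.md`).
-/

noncomputable section

open MeasureTheory Filter Topology Set Function
open Literature.Probability.RandomPlanarGeometry Literature.Probability.RandomPlanarGeometry.SAW
open Literature.Probability.LatticeModels
open scoped ENNReal NNReal MeasureTheory Topology BigOperators Classical

namespace Summit.CriticalPhenomena.SAWScalingLimit.Cruxes.CubicRemainder.Birth

open Summit.CriticalPhenomena.SAWScalingLimit.Theses.SAWSteinDefect (CubicRemainder)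

/-! ## The registered stubs -/

/-- **stub (N) — NO RE-ENTRY: the lattice value process is absorbed at `0`** (provable now, M).
For `δ > 0`, every critical SAW `γ` of `Ω_δ` from `a_δ` to `b_δ` and every `n < |γ|`:
if `q_n := Q δ γ n = 0` then `q_{n+1} = 0`.  Here `Q δ γ n = 1[range γ[0,n] ⊆ cl D'] · H'/H` with
`H`, `H'` the `4^{-|ω|}`-masses of nearest-neighbour walks of `Ω_δ` from the tip `γ_n` to `b_δ`
avoiding `γ[0,n]` after time `0` and stopped at `b_δ` (`H'`: moreover staying in `cl D'`).
Mechanism: `range γ[0,n] ⊆ range γ[0,n+1]` (polyline of an initial piece); the series `H`, `H'` are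
summable (distinct admissible walks are first-passage cylinders of the simple random walk of `ℤ²`,
total mass `≤ 1`), `0 ≤ H' ≤ H`, `H(γ[0,n]) ≥ 4^{-(|γ|-n)} > 0` (the walk's own future is admissible),
and `ω ↦ cons (γ_n, γ_{n+1}) ω` injects the `H'`-admissible walks from `γ_{n+1}` (past `γ[0,n+1]`)
into those from `γ_n` (past `γ[0,n]`) with weight ratio `1/4` (`γ_{n+1} ∉ γ[0,n]` and `γ_n ≠ b_δ`
by self-avoidance), whence `H'(γ[0,n]) ≥ ¼ H'(γ[0,n+1])`.  Why it might fail: only by a typing slip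
(it is lattice bookkeeping plus summability); stated for `δ > 0` and `n < |γ|` only.
Sources: LawlerSchrammWerner2004SAW §3.4 (lattice restriction bookkeeping), Lawler2005 (excursion
Poisson kernel), KozdronLawler2005. -/
theorem stub_noReentry : ∀ (D D' : Literature.Probability.RandomPlanarGeometry.DobrushinDomain) (a b : ℝ → Literature.Probability.LatticeModels.Site 2), let H : ℝ → List (Literature.Probability.LatticeModels.Site 2) → Literature.Probability.LatticeModels.Site 2 → ℝ := fun δ S w => ∑' ω : (Literature.Probability.LatticeModels.discreteDomainGraph D.carrier δ).Walk w (b δ), if (∀ v ∈ ω.support.tail, v ∉ S) ∧ b δ ∉ ω.support.dropLast then (1 / 4 : ℝ) ^ ω.length else 0; let H' : ℝ → List (Literature.Probability.LatticeModels.Site 2) → Literature.Probability.LatticeModels.Site 2 → ℝ := fun δ S w => ∑' ω : (Literature.Probability.LatticeModels.discreteDomainGraph D.carrier δ).Walk w (b δ), if (∀ v ∈ ω.support.tail, v ∉ S) ∧ b δ ∉ ω.support.dropLast ∧ Set.range (ω.toCurve (Literature.Probability.LatticeModels.meshPoint δ)) ⊆ closure D'.carrier then (1 / 4 : ℝ)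 ^ ω.length else 0; let Q : (δ : ℝ) → Literature.Probability.RandomPlanarGeometry.SAW.DomainSAW D.carrier δ (a δ) (b δ) → ℕ → ℝ := fun δ γ n => if Set.range ((γ.walk.take n).toCurve (Literature.Probability.LatticeModels.meshPoint δ)) ⊆ closure D'.carrier then H' δ (γ.walk.take n).support (γ.walk.getVert n) / H δ (γ.walk.take n).support (γ.walk.getVert n) else 0; ∀ δ : ℝ, 0 < δ → ∀ (γ : Literature.Probability.RandomPlanarGeometry.SAW.DomainSAW D.carrier δ (a δ) (b δ)) (n : ℕ), n < γ.length → Q δ γ n = 0 → Q δ γ (n + 1) = 0 := by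
  sorry

/-- **stub (A) — ABSORPTION ONLY FROM SMALL VALUES** (OPEN, L; the "absorption" half of the
route's two-layer plan for (R)).  In the setting of the crux (Dobrushin `D`, hull subdomain `D'`
agreeing with `D` near `a, b`, endpoint approximation), the law-averaged sum over ABSORPTION steps
(`q_n ≠ 0`, `q_{n+1} = 0`) of `q_n^{5/8}` tends to `0` as `δ → 0⁺`:
`E_δ Σ_{n<N} 1[q_n ≠ 0, q_{n+1} = 0] q_n^{5/8} → 0`.  By (N) absorption happens at most once, at the
step `τ − 1 → τ` where the past first leaves `cl D'` (or the tip becomes doomed), so this is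
`E_δ[q_{τ−1}^{5/8}; τ ≤ N] → 0`: one lattice step before exiting `cl D'` the excursion-avoidance
ratio is small on average (gambler's-ruin / discrete Beurling decay of `q` at lattice distance `O(1)`
from `D ∖ D'`, uniformly over SAW pasts), and exits through "doomed pockets" carry no mass in the
limit.  Each absorption step costs exactly `−(33/128) q_n^{5/8}` in the crux's sum.  Why it might
fail: absorption at `q ≍ 1` with non-vanishing probability — a polymer whose tip jumps out of `cl D'`
from a past screened from `D ∖ D'` (fjords), or macroscopic mass of doomed-pocket exits; dominant at
toy sizes (planner's enumeration: remainder `R = −0.09 … −0.045` at 15–35 sites).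
Sources: KennedyLawler2013, KozdronLawler2005, Chelkak2016, LawlerSchrammWerner2004SAW, Lawler2005. -/
theorem stub_absorption : ∀ (D D' : Literature.Probability.RandomPlanarGeometry.DobrushinDomain) (a b : ℝ → Literature.Probability.LatticeModels.Site 2), let H : ℝ → List (Literature.Probability.LatticeModels.Site 2) → Literature.Probability.LatticeModels.Site 2 → ℝ := fun δ S w => ∑' ω : (Literature.Probability.LatticeModels.discreteDomainGraph D.carrier δ).Walk w (b δ), if (∀ v ∈ ω.support.tail, v ∉ S) ∧ b δ ∉ ω.support.dropLast then (1 / 4 : ℝ) ^ ω.length else 0; let H' : ℝ → List (Literature.Probability.LatticeModels.Site 2) → Literature.Probability.LatticeModels.Site 2 → ℝ := fun δ S w => ∑' ω : (Literature.Probability.LatticeModels.discreteDomainGraph D.carrier δ).Walk w (b δ), if (∀ v ∈ ω.support.tail, v ∉ S) ∧ b δ ∉ ω.support.dropLast ∧ Set.range (ω.toCurve (Literature.Probability.LatticeModels.meshPoint δ)) ⊆ closure D'.carrier then (1 / 4 : ℝ) ^ ω.length else 0; let Q : (δ : ℝ) → Literature.Probability.RandomPlanarGeometry.SAW.DomainSAW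 D.carrier δ (a δ) (b δ) → ℕ → ℝ := fun δ γ n => if Set.range ((γ.walk.take n).toCurve (Literature.Probability.LatticeModels.meshPoint δ)) ⊆ closure D'.carrier then H' δ (γ.walk.take n).support (γ.walk.getVert n) / H δ (γ.walk.take n).support (γ.walk.getVert n) else 0; Literature.Probability.RandomPlanarGeometry.SAW.IsEndpointApprox D a b → D'.carrier ⊆ D.carrier → D'.pt 0 = D.pt 0 → D'.pt 1 = D.pt 1 → (∃ ε : ℝ, 0 < ε ∧ D'.carrier ∩ Metric.ball (D.pt 0) ε = D.carrier ∩ Metric.ball (D.pt 0) ε ∧ D'.carrier ∩ Metric.ball (D.pt 1) ε = D.carrier ∩ Metric.ball (D.pt 1) ε) → Filter.Tendsto (fun δ => ∫ γ, (∑ n ∈ Finset.range γ.length, if Q δ γ n ≠ 0 ∧ Q δ γ (n + 1) = 0 then Q δ γ n ^ ((5 : ℝ) / 8) else 0) ∂(Literature.Probability.RandomPlanarGeometry.SAW.law D.carrier δ (a δ) (b δ))) (nhdsWithin 0 (Set.Ioi 0)) (nhds 0) := by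
  sorry

/-- **stub (C) — INTERIOR TAYLOR REMAINDER IS SUMMABLE TO `o(1)`** (OPEN, L; the "bulk" half of the
route's two-layer plan for (R)).  In the setting of the crux, the law-averaged sum over INTERIOR
steps (`q_n ≠ 0`, `q_{n+1} ≠ 0`) of the absolute third-order Taylor remainder of `q ↦ q^{5/8}`,
`E_δ Σ_{n<N} 1[q_n ≠ 0, q_{n+1} ≠ 0] |q_{n+1}^{5/8} − q_n^{5/8} − (5/8) q_n^{−3/8} Δq_n + (15/128) q_n^{−11/8} Δq_n²|`,
tends to `0` as `δ → 0⁺`.  For interior steps `|R_n| ≍ q_n^{−11/8} Δq_n² min(1, |Δq_n|/q_n)`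
(`= (165/3072) ξ^{−19/8} |Δq_n|³`, `ξ` between `q_n` and `q_{n+1}`), so the content is third-order
smallness of the RELATIVE one-step jumps of the excursion-avoidance ratio along SAW pasts:
`|Δq/q| ≲ 1/k` at lattice distance `kδ` from `D ∖ D'` (discrete Harnack for ratios of slit-domain
Poisson kernels at the tip, with fjords) and no pile-up of steps at bounded lattice distance from
`∂D' ∩ D` (in conformal coordinates `Σ_n |Δξ_n|³ ≲ (max_n Δt_n)^{1/2} · hcap = O(δ^{1/2})` in the bulk).
Why it might fail: rare pasts with `q_n` exponentially small followed by a jump to `q_{n+1} ≍ 1`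
(tip entering a corridor of its own past that screens `D ∖ D'`) weigh `≍ q_n^{−11/8}`; the stub needs
such configurations to have probability `o(q^{11/8})` under the critical law, and a polymer creeping
along `∂D'` for `≫ δ^{-1/2}` steps breaks the bulk estimate.
Sources: KennedyLawler2013, Chelkak2016, KozdronLawler2005, LawlerSchrammWerner2003Restriction §5,
Lawler2005. -/
theorem stub_interiorRemainder : ∀ (D D' : Literature.Probability.RandomPlanarGeometry.DobrushinDomain) (a b : ℝ → Literature.Probability.LatticeModels.Site 2), let H : ℝ → List (Literature.Probability.LatticeModels.Site 2) → Literature.Probability.LatticeModels.Site 2 → ℝ := fun δ S w => ∑' ω : (Literature.Probability.LatticeModels.discreteDomainGraph D.carrier δ).Walk w (b δ), if (∀ v ∈ ω.support.tail, v ∉ S) ∧ b δ ∉ ω.support.dropLast then (1 / 4 : ℝ) ^ ω.length else 0; let H' : ℝ → List (Literature.Probability.LatticeModels.Site 2) → Literature.Probability.LatticeModels.Site 2 → ℝ := fun δ S w => ∑' ω : (Literature.Probability.LatticeModels.discreteDomainGraph D.carrier δ).Walk w (b δ), if (∀ v ∈ ω.support.tail, v ∉ S) ∧ b δ ∉ ω.support.dropLast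 ∧ Set.range (ω.toCurve (Literature.Probability.LatticeModels.meshPoint δ)) ⊆ closure D'.carrier then (1 / 4 : ℝ) ^ ω.length else 0; let Q : (δ : ℝ) → Literature.Probability.RandomPlanarGeometry.SAW.DomainSAW D.carrier δ (a δ) (b δ) → ℕ → ℝ := fun δ γ n => if Set.range ((γ.walk.take n).toCurve (Literature.Probability.LatticeModels.meshPoint δ)) ⊆ closure D'.carrier then H' δ (γ.walk.take n).support (γ.walk.getVert n) / H δ (γ.walk.take n).support (γ.walk.getVert n) else 0; Literature.Probability.RandomPlanarGeometry.SAW.IsEndpointApprox D a b → D'.carrier ⊆ D.carrier → D'.pt 0 = D.pt 0 → D'.pt 1 = D.pt 1 → (∃ ε : ℝ, 0 < ε ∧ D'.carrier ∩ Metric.ball (D.pt 0) ε = D.carrier ∩ Metric.ball (D.pt 0) ε ∧ D'.carrier ∩ Metric.ball (D.pt 1) ε = D.carrier ∩ Metric.ball (D.pt 1) ε) → Filter.Tendsto (fun δ => ∫ γ, (∑ n ∈ Finset.range γ.length, if Q δ γ n ≠ 0 ∧ Q δ γ (n + 1) ≠ 0 then |Q δ γ (n + 1) ^ ((5 : ℝ)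 / 8) - Q δ γ n ^ ((5 : ℝ) / 8) - (5 / 8 : ℝ) * Q δ γ n ^ (-(3 : ℝ) / 8) * (Q δ γ (n + 1) - Q δ γ n) + (15 / 128 : ℝ) * Q δ γ n ^ (-(11 : ℝ) / 8) * (Q δ γ (n + 1) - Q δ γ n) ^ 2| else 0) ∂(Literature.Probability.RandomPlanarGeometry.SAW.law D.carrier δ (a δ) (b δ))) (nhdsWithin 0 (Set.Ioi 0)) (nhds 0) := by
  sorry

/-! ## Name-keyed aliases of the stub statements

The skeleton audit (`#h21_check_skeleton`) admits a hypothesis of the skeleton theorem only if its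
head constant is a registered obligation or is NAMED like a declared stub; `__Registered.stub_X` is the
statement of `stub_X` under that name (device of `Cruxes/AxiomsOfLimit/Lines/birth.lean` and
`Cruxes/AsymptoticMorera/Lines/birth.lean`; the `__` namespace is an implementation detail, so the
audit's stub report resolves each `stub_…` to the sorried theorem, not to the alias).  Each alias is
the verbatim statement of its stub (definitionally equal, see the consistency theorems below). -/

namespace __Registered

/-- Alias keyed by the stub name: the statement of `stub_noReentry`. -/
abbrev stub_noReentry : Prop :=
  ∀ (D D' : Literature.Probability.RandomPlanarGeometry.DobrushinDomain) (a b : ℝ → Literature.Probability.LatticeModels.Site 2), let H : ℝ → List (Literature.Probability.LatticeModels.Site 2) → Literature.Probability.LatticeModels.Site 2 → ℝ := fun δ S w => ∑' ω : (Literature.Probability.LatticeModels.discreteDomainGraph D.carrier δ).Walk w (b δ), if (∀ v ∈ ω.support.tail, v ∉ S) ∧ b δ ∉ ω.support.dropLast then (1 / 4 : ℝ) ^ ω.length else 0; let H' : ℝ → List (Literature.Probability.LatticeModels.Site 2) → Literature.Probability.LatticeModels.Site 2 → ℝ := fun δ S w => ∑' ω : (Literature.Probability.LatticeModels.discreteDomainGraph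 D.carrier δ).Walk w (b δ), if (∀ v ∈ ω.support.tail, v ∉ S) ∧ b δ ∉ ω.support.dropLast ∧ Set.range (ω.toCurve (Literature.Probability.LatticeModels.meshPoint δ)) ⊆ closure D'.carrier then (1 / 4 : ℝ) ^ ω.length else 0; let Q : (δ : ℝ) → Literature.Probability.RandomPlanarGeometry.SAW.DomainSAW D.carrier δ (a δ) (b δ) → ℕ → ℝ := fun δ γ n => if Set.range ((γ.walk.take n).toCurve (Literature.Probability.LatticeModels.meshPoint δ)) ⊆ closure D'.carrier then H' δ (γ.walk.take n).support (γ.walk.getVert n) / H δ (γ.walk.take n).support (γ.walk.getVert n) else 0; ∀ δ : ℝ, 0 < δ → ∀ (γ : Literature.Probability.RandomPlanarGeometry.SAW.DomainSAW D.carrier δ (a δ) (b δ)) (n : ℕ), n < γ.length → Q δ γ n = 0 → Q δ γ (n + 1) = 0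

/-- Alias keyed by the stub name: the statement of `stub_absorption`. -/
abbrev stub_absorption : Prop :=
  ∀ (D D' : Literature.Probability.RandomPlanarGeometry.DobrushinDomain) (a b : ℝ → Literature.Probability.LatticeModels.Site 2), let H : ℝ → List (Literature.Probability.LatticeModels.Site 2) → Literature.Probability.LatticeModels.Site 2 → ℝ := fun δ S w => ∑' ω : (Literature.Probability.LatticeModels.discreteDomainGraph D.carrier δ).Walk w (b δ), if (∀ v ∈ ω.support.tail, v ∉ S) ∧ b δ ∉ ω.support.dropLast then (1 / 4 : ℝ) ^ ω.length else 0; let H' : ℝ → List (Literature.Probability.LatticeModels.Site 2) → Literature.Probability.LatticeModels.Site 2 → ℝ := fun δ S w => ∑' ω : (Literature.Probability.LatticeModels.discreteDomainGraph D.carrier δ).Walk w (b δ), if (∀ v ∈ ω.support.tail, v ∉ S) ∧ b δ ∉ ω.support.dropLast ∧ Set.range (ω.toCurve (Literature.Probability.LatticeModels.meshPoint δ)) ⊆ closure D'.carrier then (1 / 4 : ℝ) ^ ω.length else 0; let Q : (δ : ℝ) → Literature.Probability.RandomPlanarGeometry.SAW.DomainSAW D.carrier δ (a δ) (b δ) →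 ℕ → ℝ := fun δ γ n => if Set.range ((γ.walk.take n).toCurve (Literature.Probability.LatticeModels.meshPoint δ)) ⊆ closure D'.carrier then H' δ (γ.walk.take n).support (γ.walk.getVert n) / H δ (γ.walk.take n).support (γ.walk.getVert n) else 0; Literature.Probability.RandomPlanarGeometry.SAW.IsEndpointApprox D a b → D'.carrier ⊆ D.carrier → D'.pt 0 = D.pt 0 → D'.pt 1 = D.pt 1 → (∃ ε : ℝ, 0 < ε ∧ D'.carrier ∩ Metric.ball (D.pt 0) ε = D.carrier ∩ Metric.ball (D.pt 0) ε ∧ D'.carrier ∩ Metric.ball (D.pt 1) ε = D.carrier ∩ Metric.ball (D.pt 1) ε) → Filter.Tendsto (fun δ => ∫ γ, (∑ n ∈ Finset.range γ.length, if Q δ γ n ≠ 0 ∧ Q δ γ (n + 1) = 0 then Q δ γ n ^ ((5 : ℝ) / 8) else 0) ∂(Literature.Probability.RandomPlanarGeometry.SAW.law D.carrier δ (a δ) (b δ))) (nhdsWithin 0 (Set.Ioi 0)) (nhds 0)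

/-- Alias keyed by the stub name: the statement of `stub_interiorRemainder`. -/
abbrev stub_interiorRemainder : Prop :=
  ∀ (D D' : Literature.Probability.RandomPlanarGeometry.DobrushinDomain) (a b : ℝ → Literature.Probability.LatticeModels.Site 2), let H : ℝ → List (Literature.Probability.LatticeModels.Site 2) → Literature.Probability.LatticeModels.Site 2 → ℝ := fun δ S w => ∑' ω : (Literature.Probability.LatticeModels.discreteDomainGraph D.carrier δ).Walk w (b δ), if (∀ v ∈ ω.support.tail, v ∉ S) ∧ b δ ∉ ω.support.dropLast then (1 / 4 : ℝ) ^ ω.length else 0; let H' : ℝ → List (Literature.Probability.LatticeModels.Site 2) → Literature.Probability.LatticeModels.Site 2 → ℝ := fun δ S w => ∑' ω : (Literature.Probability.LatticeModels.discreteDomainGraph D.carrier δ).Walk w (b δ), if (∀ v ∈ ω.support.tail, v ∉ S) ∧ b δ ∉ ω.support.dropLast ∧ Set.range (ω.toCurve (Literature.Probability.LatticeModels.meshPoint δ)) ⊆ closure D'.carrier then (1 / 4 : ℝ) ^ ω.length else 0; let Q : (δ : ℝ) → Literature.Probability.RandomPlanarGeometry.SAW.DomainSAW D.carrier δ (a δ)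 (b δ) → ℕ → ℝ := fun δ γ n => if Set.range ((γ.walk.take n).toCurve (Literature.Probability.LatticeModels.meshPoint δ)) ⊆ closure D'.carrier then H' δ (γ.walk.take n).support (γ.walk.getVert n) / H δ (γ.walk.take n).support (γ.walk.getVert n) else 0; Literature.Probability.RandomPlanarGeometry.SAW.IsEndpointApprox D a b → D'.carrier ⊆ D.carrier → D'.pt 0 = D.pt 0 → D'.pt 1 = D.pt 1 → (∃ ε : ℝ, 0 < ε ∧ D'.carrier ∩ Metric.ball (D.pt 0) ε = D.carrier ∩ Metric.ball (D.pt 0) ε ∧ D'.carrier ∩ Metric.ball (D.pt 1) ε = D.carrier ∩ Metric.ball (D.pt 1) ε) → Filter.Tendsto (fun δ => ∫ γ, (∑ n ∈ Finset.range γ.length, if Q δ γ n ≠ 0 ∧ Q δ γ (n + 1) ≠ 0 then |Q δ γ (n + 1) ^ ((5 : ℝ) / 8) - Q δ γ n ^ ((5 : ℝ) / 8) - (5 / 8 : ℝ) * Q δ γ n ^ (-(3 : ℝ) / 8) * (Q δ γ (n + 1) - Q δ γ n) + (15 / 128 : ℝ) * Q δ γ n ^ (-(11 : ℝ) / 8)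 * (Q δ γ (n + 1) - Q δ γ n) ^ 2| else 0) ∂(Literature.Probability.RandomPlanarGeometry.SAW.law D.carrier δ (a δ) (b δ))) (nhdsWithin 0 (Set.Ioi 0)) (nhds 0)

end __Registered

/-! Consistency: each alias IS its registered stub (the sorried theorem proves the alias by `exact`). -/

theorem noReentry_holds : __Registered.stub_noReentry := stub_noReentry
theorem absorption_holds : __Registered.stub_absorption := stub_absorption
theorem interiorRemainder_holds : __Registered.stub_interiorRemainder := stub_interiorRemainder

/-! ## Proved glue -/

/-- **One step of the Taylor split.**  For `x ≥ 0` (the current value) and `y` (the next value) with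
`x = 0 → y = 0` (no re-entry), the remainder `R(x, y) = y^{5/8} − x^{5/8} − (5/8)x^{−3/8}(y − x) +
(15/128)x^{−11/8}(y − x)²` satisfies `|R| ≤ 1[x ≠ 0, y ≠ 0]|R| + (33/128)·1[x ≠ 0, y = 0] x^{5/8}`:
on a dead step `R(0,0) = 0`, and on an absorption step `R(x, 0) = −(33/128) x^{5/8}` exactly
(`0^(5/8) = 0`, `x^{−3/8}·x = x^{5/8}`, `x^{−11/8}·x² = x^{5/8}`, `−1 + 5/8 + 15/128 = −33/128`).
[folklore] -/
theorem summand_abs_le {x y : ℝ} (hx : 0 ≤ x) (hxy : x = 0 → y = 0) :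
    |y ^ ((5 : ℝ) / 8) - x ^ ((5 : ℝ) / 8) - (5 / 8 : ℝ) * x ^ (-(3 : ℝ) / 8) * (y - x) + (15 / 128 : ℝ) * x ^ (-(11 : ℝ) / 8) * (y - x) ^ 2|
      ≤ (if x ≠ 0 ∧ y ≠ 0 then |y ^ ((5 : ℝ) / 8) - x ^ ((5 : ℝ) / 8) - (5 / 8 : ℝ) * x ^ (-(3 : ℝ) / 8) * (y - x) + (15 / 128 : ℝ) * x ^ (-(11 : ℝ) / 8) * (y - x) ^ 2| else 0)
        + (33 / 128 : ℝ) * (if x ≠ 0 ∧ y = 0 then x ^ ((5 : ℝ) / 8) else 0) := by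
  by_cases hx0 : x = 0
  · have hy0 : y = 0 := hxy hx0
    subst hx0
    subst hy0
    simp
  · by_cases hy0 : y = 0
    · subst hy0
      have hxpos : 0 < x := lt_of_le_of_ne hx (Ne.symm hx0)
      have h1 : x ^ ((5 : ℝ) / 8) = x ^ (-(3 : ℝ) / 8) * x := by
        rw [← Real.rpow_add_one hx0]
        norm_num
      have h2 : x ^ ((5 : ℝ) / 8) = x ^ (-(11 : ℝ) / 8) * x ^ 2 := by
        rw [← Real.rpow_two, ← Real.rpow_add hxpos]
        norm_num
      have hR : (0 : ℝ) ^ ((5 : ℝ) / 8) - x ^ ((5 : ℝ) / 8) - (5 / 8 : ℝ) * x ^ (-(3 : ℝ) / 8) * (0 - x)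
            + (15 / 128 : ℝ) * x ^ (-(11 : ℝ) / 8) * (0 - x) ^ 2
          = -((33 / 128 : ℝ) * x ^ ((5 : ℝ) / 8)) := by
        rw [Real.zero_rpow (by norm_num)]
        have e1 : (5 / 8 : ℝ) * x ^ (-(3 : ℝ) / 8) * (0 - x) = -((5 / 8 : ℝ) * x ^ ((5 : ℝ) / 8)) := by
          rw [h1]; ring
        have e2 : (15 / 128 : ℝ) * x ^ (-(11 : ℝ) / 8) * (0 - x) ^ 2
            = (15 / 128 : ℝ) * x ^ ((5 : ℝ) / 8) := by
          rw [h2]; ring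
        rw [e1, e2]
        ring
      rw [hR, abs_neg, abs_of_nonneg (by positivity)]
      simp [hx0]
    · simp [hx0, hy0]

/-- **Pointwise split of the remainder sum along one walk.**  For a nonnegative sequence `q` absorbed
at `0` on `[0, N)`, the Taylor-remainder sum is bounded in absolute value by the interior sum of
`|R_n|` plus `33/128` times the absorption sum of `q_n^{5/8}`. [folklore] -/
theorem sum_abs_le {N : ℕ} (q : ℕ → ℝ) (hq : ∀ n, 0 ≤ q n)
    (hN : ∀ n, n < N → q n = 0 → q (n + 1) = 0) :
    |∑ n ∈ Finset.range N, (q (n + 1) ^ ((5 : ℝ) / 8) - q n ^ ((5 : ℝ) / 8) - (5 / 8 : ℝ) * q n ^ (-(3 : ℝ) / 8) * (q (n + 1) - q n) + (15 / 128 : ℝ) * q n ^ (-(11 : ℝ) / 8) * (q (n + 1) - q n) ^ 2)|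
      ≤ (∑ n ∈ Finset.range N, (if q n ≠ 0 ∧ q (n + 1) ≠ 0 then |q (n + 1) ^ ((5 : ℝ) / 8) - q n ^ ((5 : ℝ) / 8) - (5 / 8 : ℝ) * q n ^ (-(3 : ℝ) / 8) * (q (n + 1) - q n) + (15 / 128 : ℝ) * q n ^ (-(11 : ℝ) / 8) * (q (n + 1) - q n) ^ 2| else 0))
        + (33 / 128 : ℝ) * ∑ n ∈ Finset.range N,
            (if q n ≠ 0 ∧ q (n + 1) = 0 then q n ^ ((5 : ℝ) / 8) else 0) := by
  calc |∑ n ∈ Finset.range N, (q (n + 1) ^ ((5 : ℝ) / 8) - q n ^ ((5 : ℝ) / 8) - (5 / 8 : ℝ) * q n ^ (-(3 : ℝ) / 8) * (q (n + 1) - q n) + (15 / 128 : ℝ) * q n ^ (-(11 : ℝ) / 8) * (q (n + 1) - q n) ^ 2)|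
        ≤ ∑ n ∈ Finset.range N, |q (n + 1) ^ ((5 : ℝ) / 8) - q n ^ ((5 : ℝ) / 8) - (5 / 8 : ℝ) * q n ^ (-(3 : ℝ) / 8) * (q (n + 1) - q n) + (15 / 128 : ℝ) * q n ^ (-(11 : ℝ) / 8) * (q (n + 1) - q n) ^ 2| := Finset.abs_sum_le_sum_abs _ _
    _ ≤ ∑ n ∈ Finset.range N, ((if q n ≠ 0 ∧ q (n + 1) ≠ 0 then |q (n + 1) ^ ((5 : ℝ) / 8) - q n ^ ((5 : ℝ) / 8) - (5 / 8 : ℝ) * q n ^ (-(3 : ℝ) / 8) * (q (n + 1) - q n) + (15 / 128 : ℝ) * q n ^ (-(11 : ℝ) / 8) * (q (n + 1) - q n) ^ 2| else 0)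
          + (33 / 128 : ℝ) * (if q n ≠ 0 ∧ q (n + 1) = 0 then q n ^ ((5 : ℝ) / 8) else 0)) :=
        Finset.sum_le_sum fun n hn => summand_abs_le (hq n) (hN n (Finset.mem_range.1 hn))
    _ = (∑ n ∈ Finset.range N, (if q n ≠ 0 ∧ q (n + 1) ≠ 0 then |q (n + 1) ^ ((5 : ℝ) / 8) - q n ^ ((5 : ℝ) / 8) - (5 / 8 : ℝ) * q n ^ (-(3 : ℝ) / 8) * (q (n + 1) - q n) + (15 / 128 : ℝ) * q n ^ (-(11 : ℝ) / 8) * (q (n + 1) - q n) ^ 2| else 0))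
        + (33 / 128 : ℝ) * ∑ n ∈ Finset.range N,
            (if q n ≠ 0 ∧ q (n + 1) = 0 then q n ^ ((5 : ℝ) / 8) else 0) := by
        rw [Finset.sum_add_distrib, Finset.mul_sum]

/-- The critical SAW law of `Ω_δ` is a finite measure (total mass `≤ 1`; junk value `0` when no SAW
joins the endpoints). [folklore] -/
theorem isFiniteMeasure_law (Ω : Set ℂ) (δ : ℝ) (u v : Site 2) :
    IsFiniteMeasure (SAW.law Ω δ u v) :=
  ⟨(SAW.law_apply_le_one Ω δ u v Set.univ).trans_lt ENNReal.one_lt_top⟩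

/-- **Abstract squeeze: the remainder functional from its three pieces.**  For ANY value process
`Q δ γ n` along the critical SAWs of `(D; a, b)` that is nonnegative and absorbed at `0` for `δ > 0`,
if the law-averaged absorption sum of `Q^{5/8}` and the law-averaged interior sum of `|R_n|` tend to
`0` as `δ → 0⁺`, then so does the law-averaged Taylor-remainder sum.  Proof: pointwise `sum_abs_le`;
for `δ > 0` the walk space is finite (`SAW.finite_domainSAW`, bounded Jordan carrier) and the law is
finite, so everything is integrable and the integral is monotone and linear; squeeze along `𝓝[>] 0`.
[folklore] -/
theorem tendsto_integral_remainder {D : DobrushinDomain} {a b : ℝ → Site 2}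
    (Q : (δ : ℝ) → SAW.DomainSAW D.carrier δ (a δ) (b δ) → ℕ → ℝ)
    (hQ : ∀ δ : ℝ, 0 < δ → ∀ (γ : SAW.DomainSAW D.carrier δ (a δ) (b δ)) (n : ℕ), 0 ≤ Q δ γ n)
    (hN : ∀ δ : ℝ, 0 < δ → ∀ (γ : SAW.DomainSAW D.carrier δ (a δ) (b δ)) (n : ℕ),
      n < γ.length → Q δ γ n = 0 → Q δ γ (n + 1) = 0)
    (hA : Filter.Tendsto (fun δ => ∫ γ, (∑ n ∈ Finset.range γ.length,
        if Q δ γ n ≠ 0 ∧ Q δ γ (n + 1) = 0 then Q δ γ n ^ ((5 : ℝ) / 8) else 0)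
          ∂(SAW.law D.carrier δ (a δ) (b δ))) (nhdsWithin 0 (Set.Ioi 0)) (nhds 0))
    (hC : Filter.Tendsto (fun δ => ∫ γ, (∑ n ∈ Finset.range γ.length,
        if Q δ γ n ≠ 0 ∧ Q δ γ (n + 1) ≠ 0 then |Q δ γ (n + 1) ^ ((5 : ℝ) / 8) - Q δ γ n ^ ((5 : ℝ) / 8) - (5 / 8 : ℝ) * Q δ γ n ^ (-(3 : ℝ) / 8) * (Q δ γ (n + 1) - Q δ γ n) + (15 / 128 : ℝ) * Q δ γ n ^ (-(11 : ℝ) / 8) * (Q δ γ (n + 1) - Q δ γ n) ^ 2| else 0)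
          ∂(SAW.law D.carrier δ (a δ) (b δ))) (nhdsWithin 0 (Set.Ioi 0)) (nhds 0)) :
    Filter.Tendsto (fun δ => ∫ γ, (∑ n ∈ Finset.range γ.length, (Q δ γ (n + 1) ^ ((5 : ℝ) / 8) - Q δ γ n ^ ((5 : ℝ) / 8) - (5 / 8 : ℝ) * Q δ γ n ^ (-(3 : ℝ) / 8) * (Q δ γ (n + 1) - Q δ γ n) + (15 / 128 : ℝ) * Q δ γ n ^ (-(11 : ℝ) / 8) * (Q δ γ (n + 1) - Q δ γ n) ^ 2))
        ∂(SAW.law D.carrier δ (a δ) (b δ))) (nhdsWithin 0 (Set.Ioi 0)) (nhds 0) := by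
  refine squeeze_zero_norm' ?_ (by simpa using hC.add (hA.const_mul (33 / 128 : ℝ)))
  filter_upwards [self_mem_nhdsWithin] with δ hδ
  have hδ' : 0 < δ := hδ
  haveI : Finite (SAW.DomainSAW D.carrier δ (a δ) (b δ)) := SAW.finite_domainSAW D.isBounded hδ' _ _
  haveI : IsFiniteMeasure (SAW.law D.carrier δ (a δ) (b δ)) := isFiniteMeasure_law _ _ _ _
  rw [Real.norm_eq_abs]
  calc |∫ γ, (∑ n ∈ Finset.range γ.length, (Q δ γ (n + 1) ^ ((5 : ℝ) / 8) - Q δ γ n ^ ((5 : ℝ) / 8) - (5 / 8 : ℝ) * Q δ γ n ^ (-(3 : ℝ) / 8) * (Q δ γ (n + 1) - Q δ γ n) + (15 / 128 : ℝ) * Q δ γ n ^ (-(11 : ℝ) / 8) * (Q δ γ (n + 1) - Q δ γ n) ^ 2)) ∂(SAW.law D.carrier δ (a δ) (b δ))|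
        ≤ ∫ γ, |∑ n ∈ Finset.range γ.length, (Q δ γ (n + 1) ^ ((5 : ℝ) / 8) - Q δ γ n ^ ((5 : ℝ) / 8) - (5 / 8 : ℝ) * Q δ γ n ^ (-(3 : ℝ) / 8) * (Q δ γ (n + 1) - Q δ γ n) + (15 / 128 : ℝ) * Q δ γ n ^ (-(11 : ℝ) / 8) * (Q δ γ (n + 1) - Q δ γ n) ^ 2)| ∂(SAW.law D.carrier δ (a δ) (b δ)) :=
          abs_integral_le_integral_abs
    _ ≤ ∫ γ, ((∑ n ∈ Finset.range γ.length,
              (if Q δ γ n ≠ 0 ∧ Q δ γ (n + 1) ≠ 0 then |Q δ γ (n + 1) ^ ((5 : ℝ) / 8) - Q δ γ n ^ ((5 : ℝ) / 8) - (5 / 8 : ℝ) * Q δ γ n ^ (-(3 : ℝ) / 8) * (Q δ γ (n + 1) - Q δ γ n) + (15 / 128 : ℝ) * Q δ γ n ^ (-(11 : ℝ) / 8) * (Q δ γ (n + 1) - Q δ γ n) ^ 2| else 0))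
            + (33 / 128 : ℝ) * ∑ n ∈ Finset.range γ.length,
              (if Q δ γ n ≠ 0 ∧ Q δ γ (n + 1) = 0 then Q δ γ n ^ ((5 : ℝ) / 8) else 0))
          ∂(SAW.law D.carrier δ (a δ) (b δ)) :=
          integral_mono_of_nonneg (Eventually.of_forall fun _ => abs_nonneg _) Integrable.of_finite
            (Eventually.of_forall fun γ => sum_abs_le (Q δ γ) (hQ δ hδ' γ) (hN δ hδ' γ))
    _ = (∫ γ, (∑ n ∈ Finset.range γ.length,
              (if Q δ γ n ≠ 0 ∧ Q δ γ (n + 1) ≠ 0 then |Q δ γ (n + 1) ^ ((5 : ℝ) / 8) - Q δ γ n ^ ((5 : ℝ) / 8) - (5 / 8 : ℝ) * Q δ γ n ^ (-(3 : ℝ) / 8) * (Q δ γ (n + 1) - Q δ γ n) + (15 / 128 : ℝ) * Q δ γ n ^ (-(11 : ℝ) / 8) * (Q δ γ (n + 1) - Q δ γ n) ^ 2| else 0))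
            ∂(SAW.law D.carrier δ (a δ) (b δ)))
          + (33 / 128 : ℝ) * ∫ γ, (∑ n ∈ Finset.range γ.length,
              (if Q δ γ n ≠ 0 ∧ Q δ γ (n + 1) = 0 then Q δ γ n ^ ((5 : ℝ) / 8) else 0))
            ∂(SAW.law D.carrier δ (a δ) (b δ)) := by
          rw [integral_add Integrable.of_finite Integrable.of_finite, integral_const_mul]

/-! ## The composition: the crux BY NAME from the three stubs -/

/-- **`CubicRemainder` from (N), (A), (C).**  Fix the data of the crux; the let-bound value process
`Q` of the route is nonnegative (ratio of series of nonnegative terms, or `0`) and, by (N), absorbed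
at `0` for `δ > 0`; (A) and (C) are the two vanishing pieces; `tendsto_integral_remainder` is the
squeeze. [cite: LawlerSchrammWerner2003Restriction, §5] -/
theorem CubicRemainder_of (hN : __Registered.stub_noReentry) (hA : __Registered.stub_absorption)
    (hC : __Registered.stub_interiorRemainder) :
    Summit.CriticalPhenomena.SAWScalingLimit.Theses.SAWSteinDefect.CubicRemainder := by
  intro D D' a b H H' Q hab hD' h0 h1 hε
  refine tendsto_integral_remainder Q ?_ (hN D D' a b) (hA D D' a b hab hD' h0 h1 hε)
    (hC D D' a b hab hD' h0 h1 hε)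
  intro δ _hδ γ n
  simp only [Q, H, H']
  positivity

/-- Wiring check (an `example`, so that `CubicRemainder_of` stays the only theorem concluding the
crux): the three registered (sorried) stubs, with their stated types, are exactly the hypotheses of
`CubicRemainder_of` — this term becomes the crux proof once the three `sorry`s are discharged. -/
example : Summit.CriticalPhenomena.SAWScalingLimit.Theses.SAWSteinDefect.CubicRemainder :=
  CubicRemainder_of stub_noReentry stub_absorption stub_interiorRemainder

end Summit.CriticalPhenomena.SAWScalingLimit.Cruxes.CubicRemainder.Birth
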